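/-
Copyright (c) 2026 the pub-hodgecm-mathlib formalisation cell (harness21).  Prover seat hodgecm-mathlib-K2E5-p17 (g6), HCML Track B «K2-LIT» ∕ h413
(`stmt-HodgeConjecture-24833`), line «SC′-IRR-lev» (leaf (S-C′-irr) `sig_K2E3GL3TwoBlockInducedIrreducible`; lead K2E3-p24 (g2), dealer K2E3-plan (g4)),
brick JM-B file 1 (generic labelling): the classes of the open-cell standard sections in the `N'`-Jacquet module.  2026-09-04.
-/
import Literature.NumberTheory.Automorphic.OpenCellStandardSectionDecomposition   -- ★ `cellSection`, `cellSection_eq_sum_smoothIndRep`, `exists_eq_sum_cellSection`, `smoothIndRep_cellSection_of_conj_mem`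
import Literature.NumberTheory.Automorphic.SmoothIndOpenCellHaarFunctional        -- ★ §1 `Representation.mk_coinvariants_ne_zero_of_apply_ne_zero`, `exists_isMulRightInvariant_of_isLimitOfCompactOpen`
import Mathlib.LinearAlgebra.Dual.Lemmas
import HarnessLib

/-!
# K2_E3 road (h413), line «SC′-IRR-lev», brick JM-B (file 1 of 2) — the open cell `P_c w₀ N'` in the `N'`-JACQUET MODULE of `Ind_{P_c}^{GL_n} σ'`:
# every class of the open-cell part is a standard class `[Φ_{K₀,w}]`, the reversed Levi acts on them through `σ' ∘ Ad(w₀)` up to positive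
# rationals, and `[Φ_{K₀,w}] ≠ 0` for `w ≠ 0`

Cell `pub/hodgecm-mathlib` (D-0151), Track B, seat K2E5-p17 (g6) (hand JM-B of line «SC′-IRR-lev», lead K2E3-p24 (g2) FILE PLAN v2 10:20:22Z).
`--supports stmt-HodgeConjecture-24833 --as helper`; THEOREMS ONLY (no definition ∕ instance ∕ notation ∕ named fact ∕ `sorry`); never imports `Cruxes/…/Lines`.  COUNT-NEUTRAL.

THE MATHEMATICS ([BernsteinZelevinsky1977, Geometrical Lemma 2.12, §5 (5.1)–(5.2), Prop. 1.9 (a)]; [BernsteinZelevinsky1976, §2.22–2.25, §2.33]; [Casselman1995, §6.3]).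
`F` a non-archimedean local field, `c : Fin n → α` a MONOTONE block labelling, `P = P_c`, `w₀ = permGL Fin.revPerm`, `N' = oppositeCellRadical c` (the unipotent radical of the
REVERSED parabolic `P' = P_{toDual ∘ revLabel c}`), `σ'` a smooth representation of `P` on a bare `ℂ`-module `W`, `I = Ind_P^{GL_n} σ'` (★ `Representation.smoothIndRep`,
right translation), `I_open = vanishingOn P σ' (cellLT c w₀)` (functions vanishing off the open cell `P w₀ N'`), `Φ_{K,w} = cellSection σ' hc hσ' K _ _ w` (★ `OpenCellSections`:
`p w₀ n' ↦ 1_K(n') σ'(p) w`), and `[f]` the class of `f ∈ I` in the coinvariants of `I ∘ N'.subtype` — the carrier of the (unnormalised) Jacquet module of `I` along `N'`,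
taken in the WHOLE of `I` (not in `I_open`).  This file is the untwisted (`ψ = 1`, `U_n ↝ N'`) companion of ★ `OpenCellCoinvariants` (which treats the `(U_n, ψ)`-twisted
coinvariants of `I_open`), written so that it can be pushed into the Jacquet module of the reversed parabolic:

* §1 `mk_smoothIndRep_radical` — `[r · f] = [f]` for `r ∈ N'`; `mk_cellSection_eq_card_smul` — `[Φ_{K,w}] = |K ∕ K_s| • [Φ_{K_s,w}]` (★ `cellSection_eq_sum_smoothIndRep`);
  `exists_mk_cellSection_eq_smul` — **two boxes differ by a positive rational**: `∃ q > 0, ∀ w, [Φ_{K,w}] = q • [Φ_{K₀,w}]` (common refinement `K ⊓ K₀`).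
* §2 **`exists_eq_mk_cellSection`** — every `f ∈ I_open` has `[f] = [Φ_{K₀,w}]` for some `w` (★ `exists_eq_sum_cellSection`: `f = ∑_r r⁻¹ · Φ_{r K' r⁻¹, f(w₀ r)}`, then §1).
* §3 **`exists_mk_smoothIndRep_cellSection_eq_smul`** — for `m ∈ P'` with `w₀ m w₀⁻¹ ∈ P` (e.g. `m` in the standard Levi of `P'`): `∃ q > 0, ∀ w,
  [m · Φ_{K₀,w}] = q • [Φ_{K₀, σ'(w₀ m w₀⁻¹) w}]` (★ `smoothIndRep_cellSection_of_conj_mem`: `m · Φ_{K₀,w} = Φ_{m K₀ m⁻¹, σ'(w₀ m w₀⁻¹) w}`, then §1).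
* §4 **`mk_cellSection_ne_zero`** — `w ≠ 0 ⇒ [Φ_{K₀,w}] ≠ 0`, for a BARE `ℂ`-module `W` (★ `SmoothInd.mk_coinvariants_ne_zero_of_cellFun_eq_indicator` wants a Banach `W`): the
  SCALAR Haar functional `f ↦ ∫_{N'} ℓ(f(w₀ n')) dμ(n')` (`ℓ ∈ W^*` with `ℓ w ≠ 0`, Mathlib `Module.Projective.exists_dual_ne_zero`; right Haar `μ` on `N'`, ★
  `exists_isMulRightInvariant_of_isLimitOfCompactOpen`) on the `N'`-stable subspace of vectors with compactly supported cell function is `N'`-invariant and takes the value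
  `μ(K₀) · ℓ(w) ≠ 0` at `Φ_{K₀,w}`; ★ §1 `Representation.mk_coinvariants_ne_zero_of_apply_ne_zero` (left exactness of `N'`-coinvariants, `N'` a union of compact open subgroups ★
  `isLimitOfCompactOpen_unipotentRadicalGL`).

So `w ↦ [Φ_{K₀,w}]` is a surjection of `W` onto the image of `I_open` in the `N'`-Jacquet module of `I`, equivariant for the reversed Levi up to positive rationals, and injective on
lines — the open orbit of the Geometrical Lemma for the pair `(P_c, P')` in the weak, measure-light form the line «SC′-IRR-lev» consumes (file 2 `K2E3GL3CuspidalBlockJacquetCross`: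
`n = 3`, `c = ![0,0,1]`, where the CLOSED complement contributes nothing for a cuspidal `GL₂`-block).

HONEST LABEL: HC_CM is proved only modulo the 7 printed citations (2 remaining named inputs: hLiu418 = stmt-HodgeConjecture-24832, h413 = stmt-HodgeConjecture-24833) until rung 0
closes; count-neutral helper (kernel lane).

## Mathlib ∕ tree search
★ `OpenCellSections` ∕ `OpenCellCoinvariants` (`cellSection`, `cellSectionₗ`, `cellSection_eq_sum_smoothIndRep`, `conjSubgroup`, `oppositeCellRadical_le_reversedParabolic`,
`toFun_w₀_mul_mul_of_mem_stabilizer`), ★ `OpenCellStandardSectionDecomposition` (`exists_eq_sum_cellSection`, `smoothIndRep_cellSection_of_conj_mem`), ★ `CompactOpenAveraging`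
(`IsLeftTransversal`, `exists_isLeftTransversal`), ★ `SmoothIndOpenCellHaarFunctional` (§1–§3 pattern, Banach `W`), ★ `UnipotentRadicalCompactOpenProofs`
(`isLimitOfCompactOpen_unipotentRadicalGL`), Mathlib `Representation.Coinvariants.{mk, mk_self_apply, mk_eq_zero}`, `Module.Projective.exists_dual_ne_zero`,
`MeasureTheory.integral_indicator_const`, `integral_mul_right_eq_self`.  Dedup: `rg "OpenCellJacquet"` — none.

## References
* [BernsteinZelevinsky1977] I. N. Bernstein, A. V. Zelevinsky, *Induced representations of reductive 𝔭-adic groups I*, Ann. Sci. ÉNS 10 (1977), Prop. 1.9 (a), Lemma 2.12, §5.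
* [BernsteinZelevinsky1976] I. N. Bernstein, A. V. Zelevinsky, *Representations of the group GL(n, F) where F is a non-archimedean local field*, Russian Math. Surveys 31:3
  (1976), §2.22–2.25, §2.33.
* [Casselman1995] W. Casselman, *Introduction to the theory of admissible representations of 𝔭-adic reductive groups* (draft 1995), §6.3.
-/

set_option autoImplicit false
set_option linter.dupNamespace false   -- `Summit.HodgeConjecture.HodgeConjecture.…` (D-0017 nested layout; lakefile exemption for Summits)

noncomputable section

open scoped BigOperators Pointwise
open Matrix OrderDual Topology MeasureTheory
open Literature.NumberTheory.Automorphic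

namespace Summit.HodgeConjecture.HodgeConjecture.Cruxes.H413.K2E3OpenCellJacquetClasses

variable {F : Type*} [Field F] [ValuativeRel F] [TopologicalSpace F] [IsNonarchimedeanLocalField F]
  {n : ℕ} {α : Type*} [LinearOrder α] [Fintype α] {c : Fin n → α}
  {W : Type*} [AddCommGroup W] [Module ℂ W]
  {σ' : Representation ℂ ↥(standardParabolicGL F c) W}

/-! ## §1  Translation by `N'` and the box-change rule -/

section Boxes

omit [Fintype α] in
/-- **`[r · f] = [f]` in the `N'`-coinvariants of `I = Ind_{P_c}^{GL_n} σ'`** for `r ∈ N'`. [cite: BernsteinZelevinsky1977, §1.8] -/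
theorem mk_smoothIndRep_radical (r : ↥(oppositeCellRadical (K := F) c)) (f : Representation.SmoothInd (standardParabolicGL F c) σ') :
    Representation.Coinvariants.mk ((Representation.smoothIndRep (standardParabolicGL F c) σ').comp (oppositeCellRadical (K := F) c).subtype)
        (Representation.smoothIndRep (standardParabolicGL F c) σ' (r : GL (Fin n) F) f) =
      Representation.Coinvariants.mk ((Representation.smoothIndRep (standardParabolicGL F c) σ').comp (oppositeCellRadical (K := F) c).subtype) f :=
  Representation.Coinvariants.mk_self_apply
    ((Representation.smoothIndRep (standardParabolicGL F c) σ').comp (oppositeCellRadical (K := F) c).subtype) r f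

omit [Fintype α] in
/-- `[r⁻¹ · f] = [f]` (the form in which ★ `exists_eq_sum_cellSection` presents its summands). [cite: BernsteinZelevinsky1977, §1.8] -/
theorem mk_smoothIndRep_radical_inv (r : ↥(oppositeCellRadical (K := F) c)) (f : Representation.SmoothInd (standardParabolicGL F c) σ') :
    Representation.Coinvariants.mk ((Representation.smoothIndRep (standardParabolicGL F c) σ').comp (oppositeCellRadical (K := F) c).subtype)
        (Representation.smoothIndRep (standardParabolicGL F c) σ' ((r : GL (Fin n) F))⁻¹ f) =
      Representation.Coinvariants.mk ((Representation.smoothIndRep (standardParabolicGL F c) σ').comp (oppositeCellRadical (K := F) c).subtype) f := by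
  have h := mk_smoothIndRep_radical r⁻¹ f
  rwa [InvMemClass.coe_inv] at h

/-- **Box change, nested boxes**: for compact open subgroups `K_s ≤ K` of `N'` and a left transversal `R` of `K ∕ K_s`, `[Φ_{K,w}] = |R| • [Φ_{K_s,w}]` in the
`N'`-coinvariants of `I` (★ `cellSection_eq_sum_smoothIndRep`: `Φ_{K,w} = ∑_{r ∈ R} r · Φ_{K_s,w}`, and `[r · x] = [x]`). [cite: BernsteinZelevinsky1976, §2.22–2.24] -/
theorem mk_cellSection_eq_card_smul (hc : Monotone c) (hσ' : σ'.IsSmooth)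
    {K Ks : Subgroup ↥(oppositeCellRadical (K := F) c)} (hKs : Ks ≤ K)
    (hKo : IsOpen (K : Set ↥(oppositeCellRadical (K := F) c))) (hKc : IsCompact (K : Set ↥(oppositeCellRadical (K := F) c)))
    (hKso : IsOpen (Ks : Set ↥(oppositeCellRadical (K := F) c))) (hKsc : IsCompact (Ks : Set ↥(oppositeCellRadical (K := F) c)))
    {R : Finset ↥(oppositeCellRadical (K := F) c)} (hR : IsLeftTransversal K Ks R) (w : W) :
    Representation.Coinvariants.mk ((Representation.smoothIndRep (standardParabolicGL F c) σ').comp (oppositeCellRadical (K := F) c).subtype)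
        (cellSection σ' hc hσ' K hKo hKc w) =
      (R.card : ℂ) • Representation.Coinvariants.mk ((Representation.smoothIndRep (standardParabolicGL F c) σ').comp (oppositeCellRadical (K := F) c).subtype)
        (cellSection σ' hc hσ' Ks hKso hKsc w) := by
  rw [cellSection_eq_sum_smoothIndRep hc hσ' hKs hKo hKc hKso hKsc hR w, map_sum]
  trans ∑ r ∈ R, Representation.Coinvariants.mk ((Representation.smoothIndRep (standardParabolicGL F c) σ').comp (oppositeCellRadical (K := F) c).subtype)
      (cellSection σ' hc hσ' Ks hKso hKsc w)
  · exact Finset.sum_congr rfl fun r _ => mk_smoothIndRep_radical r _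
  · rw [Finset.sum_const, ← Nat.cast_smul_eq_nsmul ℂ]

/-- **Box change, any two boxes**: for compact open subgroups `K, K₀` of `N'` there is a POSITIVE RATIONAL `q` (namely `|K ∕ K ⊓ K₀| ∕ |K₀ ∕ K ⊓ K₀|`) with
`[Φ_{K,w}] = q • [Φ_{K₀,w}]` for every `w` (both sides are multiples of `[Φ_{K ⊓ K₀, w}]`). [cite: BernsteinZelevinsky1976, §2.22–2.24] -/
theorem exists_mk_cellSection_eq_smul (hc : Monotone c) (hσ' : σ'.IsSmooth)
    (K : Subgroup ↥(oppositeCellRadical (K := F) c)) (hKo : IsOpen (K : Set ↥(oppositeCellRadical (K := F) c)))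
    (hKc : IsCompact (K : Set ↥(oppositeCellRadical (K := F) c)))
    (K₀ : Subgroup ↥(oppositeCellRadical (K := F) c)) (hK₀o : IsOpen (K₀ : Set ↥(oppositeCellRadical (K := F) c)))
    (hK₀c : IsCompact (K₀ : Set ↥(oppositeCellRadical (K := F) c))) :
    ∃ q : ℚ, 0 < q ∧ ∀ w : W,
      Representation.Coinvariants.mk ((Representation.smoothIndRep (standardParabolicGL F c) σ').comp (oppositeCellRadical (K := F) c).subtype)
          (cellSection σ' hc hσ' K hKo hKc w) =
        (q : ℂ) • Representation.Coinvariants.mk ((Representation.smoothIndRep (standardParabolicGL F c) σ').comp (oppositeCellRadical (K := F) c).subtype)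
          (cellSection σ' hc hσ' K₀ hK₀o hK₀c w) := by
  -- the common refinement `K ⊓ K₀` and the two transversals
  have hKso : IsOpen ((K ⊓ K₀ : Subgroup ↥(oppositeCellRadical (K := F) c)) : Set ↥(oppositeCellRadical (K := F) c)) := by
    rw [Subgroup.coe_inf]; exact hKo.inter hK₀o
  have hKsc : IsCompact ((K ⊓ K₀ : Subgroup ↥(oppositeCellRadical (K := F) c)) : Set ↥(oppositeCellRadical (K := F) c)) := by
    rw [Subgroup.coe_inf]; exact hKc.inter_right (K₀.isClosed_of_isOpen hK₀o)
  obtain ⟨R, hR⟩ := exists_isLeftTransversal (B := K) hKc hK₀o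
  obtain ⟨R₀, hR₀⟩ := exists_isLeftTransversal (B := K₀) hK₀c hKo
  rw [inf_comm] at hR₀
  have hR₀pos : 0 < R₀.card := Finset.card_pos.2 hR₀.nonempty
  have hRpos : 0 < R.card := Finset.card_pos.2 hR.nonempty
  refine ⟨(R.card : ℚ) / R₀.card, div_pos (Nat.cast_pos.2 hRpos) (Nat.cast_pos.2 hR₀pos), fun w => ?_⟩
  rw [mk_cellSection_eq_card_smul hc hσ' inf_le_left hKo hKc hKso hKsc hR w,
    mk_cellSection_eq_card_smul hc hσ' inf_le_right hK₀o hK₀c hKso hKsc hR₀ w, smul_smul]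
  congr 1
  have h0 : (R₀.card : ℂ) ≠ 0 := Nat.cast_ne_zero.2 hR₀pos.ne'
  push_cast
  field_simp

end Boxes

/-! ## §2  Every class of the open-cell part is a standard class `[Φ_{K₀,w}]` -/

section Surjective

/-- **Every class of the open-cell part is a standard class**: for a compact open subgroup `K₀ ≤ N'` and `f ∈ I_open` there is `w ∈ W` with `[f] = [Φ_{K₀,w}]` in the
`N'`-coinvariants of `I` (★ `exists_eq_sum_cellSection`: `f = ∑_{r ∈ R} r⁻¹ · Φ_{r K' r⁻¹, f(w₀ r)}` for a compact open `K' ≤ N'` fixing `f`; then `[r⁻¹ · x] = [x]`, the box change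
`[Φ_{r K' r⁻¹, u}] = q_r • [Φ_{K₀, u}]` and linearity of `w ↦ Φ_{K₀,w}` give `w = ∑_r q_r • f(w₀ r)`). [cite: BernsteinZelevinsky1977, Lemma 2.12 and §5 (5.2)] -/
theorem exists_eq_mk_cellSection (hc : Monotone c) (hσ' : σ'.IsSmooth)
    (K₀ : Subgroup ↥(oppositeCellRadical (K := F) c)) (hK₀o : IsOpen (K₀ : Set ↥(oppositeCellRadical (K := F) c)))
    (hK₀c : IsCompact (K₀ : Set ↥(oppositeCellRadical (K := F) c)))
    (f : Representation.SmoothInd (standardParabolicGL F c) σ')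
    (hf : f ∈ vanishingOn (standardParabolicGL F c) σ' (cellLT (K := F) c Fin.revPerm)) :
    ∃ w : W,
      Representation.Coinvariants.mk ((Representation.smoothIndRep (standardParabolicGL F c) σ').comp (oppositeCellRadical (K := F) c).subtype) f =
        Representation.Coinvariants.mk ((Representation.smoothIndRep (standardParabolicGL F c) σ').comp (oppositeCellRadical (K := F) c).subtype)
          (cellSection σ' hc hσ' K₀ hK₀o hK₀c w) := by
  classical
  -- a compact open subgroup `K' ≤ N'` fixing `f`
  obtain ⟨T, hT⟩ : ∃ T : Subgroup ↥(oppositeCellRadical (K := F) c), T =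
      ((Representation.smoothIndRep (standardParabolicGL F c) σ').stabilizerSubgroup f).comap
        (oppositeCellRadical (K := F) c).subtype := ⟨_, rfl⟩
  have hTo : IsOpen (T : Set ↥(oppositeCellRadical (K := F) c)) := by
    rw [hT]
    exact (Representation.isSmooth_smoothInd (standardParabolicGL F c) σ' f).preimage continuous_subtype_val
  obtain ⟨K', hK'⟩ : ∃ K' : Subgroup ↥(oppositeCellRadical (K := F) c), K' = K₀ ⊓ T := ⟨_, rfl⟩
  have hK'o : IsOpen (K' : Set ↥(oppositeCellRadical (K := F) c)) := by
    rw [hK', Subgroup.coe_inf]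
    exact hK₀o.inter hTo
  have hK'c : IsCompact (K' : Set ↥(oppositeCellRadical (K := F) c)) := by
    rw [hK', Subgroup.coe_inf]
    exact hK₀c.inter_right (T.isClosed_of_isOpen hTo)
  have hK'stab : ∀ k ∈ K', ∀ x : GL (Fin n) F, f.toFun (x * (k : GL (Fin n) F)) = f.toFun x := by
    intro k hk x
    rw [hK'] at hk
    have hkT := hk.2
    rw [hT] at hkT
    exact toFun_w₀_mul_mul_of_mem_stabilizer hkT x
  -- the decomposition
  obtain ⟨R, hR⟩ := exists_eq_sum_cellSection σ' hc hσ' K' hK'o hK'c f hf hK'stab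
  -- box changes, one positive rational per summand
  have hq : ∀ r : ↥(oppositeCellRadical (K := F) c), ∃ q : ℚ, 0 < q ∧ ∀ w : W,
      Representation.Coinvariants.mk ((Representation.smoothIndRep (standardParabolicGL F c) σ').comp (oppositeCellRadical (K := F) c).subtype)
          (cellSection σ' hc hσ' (conjSubgroup (oppositeCellRadical_le_reversedParabolic c r.2) K')
            (isOpen_conjSubgroup _ hK'o) (isCompact_conjSubgroup _ hK'c) w) =
        (q : ℂ) • Representation.Coinvariants.mk ((Representation.smoothIndRep (standardParabolicGL F c) σ').comp (oppositeCellRadical (K := F) c).subtype)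
          (cellSection σ' hc hσ' K₀ hK₀o hK₀c w) := fun r =>
    exists_mk_cellSection_eq_smul hc hσ' _ _ _ K₀ hK₀o hK₀c
  choose q hqpos hq using hq
  refine ⟨∑ r ∈ R, ((q r : ℚ) : ℂ) • f.toFun (permGL Fin.revPerm * (r : GL (Fin n) F)), ?_⟩
  conv_lhs => rw [hR]
  rw [map_sum, ← cellSectionₗ_apply, map_sum, map_sum]
  refine Finset.sum_congr rfl fun r _ => ?_
  rw [mk_smoothIndRep_radical_inv, hq r, map_smul, cellSectionₗ_apply, map_smul]

end Surjective

/-! ## §3  The reversed Levi acts on the standard classes through `σ' ∘ Ad(w₀)`, up to positive rationals -/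

section Levi

/-- **Translation of a standard class by `m ∈ P'` with `w₀ m w₀⁻¹ ∈ P_c`** (every element of the standard Levi of the reversed parabolic `P'` qualifies, since `w₀` carries that Levi
onto the standard Levi of `P_c`): there is a positive rational `q` (the index ratio of the boxes `m K₀ m⁻¹` and `K₀`, independent of `w`) with
`[m · Φ_{K₀,w}] = q • [Φ_{K₀, σ'(w₀ m w₀⁻¹) w}]` for all `w` (★ `smoothIndRep_cellSection_of_conj_mem` + §1). [cite: BernsteinZelevinsky1977, Lemma 2.12 and §5 (5.2)] -/
theorem exists_mk_smoothIndRep_cellSection_eq_smul (hc : Monotone c) (hσ' : σ'.IsSmooth)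
    (K₀ : Subgroup ↥(oppositeCellRadical (K := F) c)) (hK₀o : IsOpen (K₀ : Set ↥(oppositeCellRadical (K := F) c)))
    (hK₀c : IsCompact (K₀ : Set ↥(oppositeCellRadical (K := F) c)))
    {m : GL (Fin n) F} (hmP' : m ∈ standardParabolicGL F (⇑toDual ∘ revLabel c))
    (hmP : permGL Fin.revPerm * m * (permGL Fin.revPerm)⁻¹ ∈ standardParabolicGL F c) :
    ∃ q : ℚ, 0 < q ∧ ∀ w : W,
      Representation.Coinvariants.mk ((Representation.smoothIndRep (standardParabolicGL F c) σ').comp (oppositeCellRadical (K := F) c).subtype)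
          (Representation.smoothIndRep (standardParabolicGL F c) σ' m (cellSection σ' hc hσ' K₀ hK₀o hK₀c w)) =
        (q : ℂ) • Representation.Coinvariants.mk ((Representation.smoothIndRep (standardParabolicGL F c) σ').comp (oppositeCellRadical (K := F) c).subtype)
          (cellSection σ' hc hσ' K₀ hK₀o hK₀c (σ' ⟨permGL Fin.revPerm * m * (permGL Fin.revPerm)⁻¹, hmP⟩ w)) := by
  obtain ⟨q, hqpos, hq⟩ := exists_mk_cellSection_eq_smul hc hσ' (conjSubgroup hmP' K₀) (isOpen_conjSubgroup _ hK₀o)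
    (isCompact_conjSubgroup _ hK₀c) K₀ hK₀o hK₀c
  refine ⟨q, hqpos, fun w => ?_⟩
  rw [smoothIndRep_cellSection_of_conj_mem σ' hc hσ' K₀ hK₀o hK₀c w hmP' hmP, hq]

end Levi

/-! ## §4  Non-vanishing of the standard classes (bare `ℂ`-module `W`: scalar Haar functional) -/

section Nonvanishing

/-- **The cell function of a standard section is an indicator**: `Φ_{K₀,w}(w₀ n') = 1_{K₀}(n') · w` for `n' ∈ N'`. [cite: BernsteinZelevinsky1976, §2.22] -/
theorem toFun_cellSection_w₀_mul (hc : Monotone c) (hσ' : σ'.IsSmooth)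
    (K₀ : Subgroup ↥(oppositeCellRadical (K := F) c)) (hK₀o : IsOpen (K₀ : Set ↥(oppositeCellRadical (K := F) c)))
    (hK₀c : IsCompact (K₀ : Set ↥(oppositeCellRadical (K := F) c))) (w : W) (x : ↥(oppositeCellRadical (K := F) c)) :
    (cellSection σ' hc hσ' K₀ hK₀o hK₀c w).toFun (permGL Fin.revPerm * (x : GL (Fin n) F)) =
      (K₀ : Set ↥(oppositeCellRadical (K := F) c)).indicator (fun _ => w) x := by
  classical
  rw [toFun_cellSection, show permGL Fin.revPerm * (x : GL (Fin n) F) = 1 * permGL Fin.revPerm * (x : GL (Fin n) F) by rw [one_mul]]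
  by_cases hx : x ∈ K₀
  · rw [Set.indicator_of_mem (show x ∈ (K₀ : Set _) from hx),
      cellSectionFun_eq_of_mem hc w (Subgroup.one_mem _) x.2 (by simpa using hx)]
    change σ' 1 w = w
    rw [map_one, Module.End.one_apply]
  · rw [Set.indicator_of_notMem (show x ∉ (K₀ : Set _) from hx),
      cellSectionFun_eq_zero_of_not_mem hc w (Subgroup.one_mem _) x.2 (by simpa using hx)]

/-- **NON-VANISHING OF THE STANDARD CLASSES IN THE `N'`-JACQUET MODULE** ([BernsteinZelevinsky1977, §5 (5.2), Prop. 1.9 (a)]; [Casselman1995, §6.3]): for a compact open subgroup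
`K₀ ≤ N'` and `w ≠ 0`, the class `[Φ_{K₀,w}]` in the `N'`-coinvariants of the WHOLE induced representation `I = Ind_{P_c}^{GL_n} σ'` is non-zero — for a BARE `ℂ`-module `W`.
Proof: pick `ℓ ∈ W^*` with `ℓ w ≠ 0` (Mathlib `Module.Projective.exists_dual_ne_zero`) and a right Haar measure `μ` on `N'` (★ `exists_isMulRightInvariant_of_isLimitOfCompactOpen`, `N'`
being the union of its compact open subgroups ★ `isLimitOfCompactOpen_unipotentRadicalGL`); on the `N'`-stable subspace `S ≤ I` of vectors whose cell function `n' ↦ f(w₀ n')` has compact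
support, `L(f) := ∫ ℓ(f(w₀ n')) dμ(n')` is a linear `N'`-invariant functional (substitution `n' ↦ n' r`), and `L(Φ_{K₀,w}) = μ(K₀) ℓ(w) ≠ 0`; ★ `Representation.mk_coinvariants_ne_zero_of_apply_ne_zero`.
[cite: BernsteinZelevinsky1977, Prop. 1.9 (a) and §5 (5.2)] [cite: Casselman1995, §6.3 (proof of Thm. 6.3.5)] -/
theorem mk_cellSection_ne_zero (hc : Monotone c) (hσ' : σ'.IsSmooth)
    (K₀ : Subgroup ↥(oppositeCellRadical (K := F) c)) (hK₀o : IsOpen (K₀ : Set ↥(oppositeCellRadical (K := F) c)))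
    (hK₀c : IsCompact (K₀ : Set ↥(oppositeCellRadical (K := F) c))) {w : W} (hw : w ≠ 0) :
    Representation.Coinvariants.mk ((Representation.smoothIndRep (standardParabolicGL F c) σ').comp (oppositeCellRadical (K := F) c).subtype)
        (cellSection σ' hc hσ' K₀ hK₀o hK₀c w) ≠ 0 := by
  borelize ↥(oppositeCellRadical (K := F) c)
  -- a functional `ℓ` seeing `w`; `N'` is a union of compact open subgroups; a right Haar measure on `N'`
  obtain ⟨ℓ, hℓ⟩ := Module.Projective.exists_dual_ne_zero ℂ hw
  have hlim : IsLimitOfCompactOpen ↥(oppositeCellRadical (K := F) c) :=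
    isLimitOfCompactOpen_unipotentRadicalGL F (⇑toDual ∘ revLabel c) (monotone_toDual_revLabel c hc)
  obtain ⟨μ, hμc, hμo, hμr⟩ := exists_isMulRightInvariant_of_isLimitOfCompactOpen (Γ := ↥(oppositeCellRadical (K := F) c)) hlim
  haveI := hμc
  haveI := hμo
  haveI := hμr
  -- the `N'`-stable subspace of vectors with compactly supported cell function
  let S : Submodule ℂ (Representation.SmoothInd (standardParabolicGL F c) σ') :=
    { carrier := {f | HasCompactSupport fun x : ↥(oppositeCellRadical (K := F) c) => f.toFun (permGL Fin.revPerm * (x : GL (Fin n) F))}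
      zero_mem' := HasCompactSupport.of_support_subset_isCompact isCompact_empty (fun x hx => hx rfl)
      add_mem' := fun {f g} hf hg => by
        change HasCompactSupport fun x : ↥(oppositeCellRadical (K := F) c) => (f + g).toFun (permGL Fin.revPerm * (x : GL (Fin n) F))
        simp only [Representation.SmoothInd.toFun_add, Pi.add_apply]
        exact hf.add hg
      smul_mem' := fun a f hf => by
        change HasCompactSupport fun x : ↥(oppositeCellRadical (K := F) c) => (a • f).toFun (permGL Fin.revPerm * (x : GL (Fin n) F))
        simp only [Representation.SmoothInd.toFun_smul, Pi.smul_apply]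
        exact hf.smul_left }
  have hS : ∀ (x : ↥(oppositeCellRadical (K := F) c)) ⦃f : Representation.SmoothInd (standardParabolicGL F c) σ'⦄, f ∈ S →
      ((Representation.smoothIndRep (standardParabolicGL F c) σ').comp (oppositeCellRadical (K := F) c).subtype) x f ∈ S :=
    fun x _ hf => SmoothInd.hasCompactSupport_cellFun_smoothIndRep (oppositeCellRadical (K := F) c).subtype (permGL Fin.revPerm) x hf
  -- integrability of the scalar cell functions on `S`
  have hint : ∀ f : S, Integrable (fun x : ↥(oppositeCellRadical (K := F) c) =>
      ℓ ((f : Representation.SmoothInd (standardParabolicGL F c) σ').toFun (permGL Fin.revPerm * (x : GL (Fin n) F)))) μ := fun f => by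
    have hlc : IsLocallyConstant fun x : ↥(oppositeCellRadical (K := F) c) =>
        ℓ ((f : Representation.SmoothInd (standardParabolicGL F c) σ').toFun (permGL Fin.revPerm * (x : GL (Fin n) F))) :=
      (SmoothInd.isLocallyConstant_cellFun (oppositeCellRadical (K := F) c).subtype (permGL Fin.revPerm) continuous_subtype_val
        (f : Representation.SmoothInd (standardParabolicGL F c) σ')).comp ℓ
    have hcs : HasCompactSupport fun x : ↥(oppositeCellRadical (K := F) c) =>
        ℓ ((f : Representation.SmoothInd (standardParabolicGL F c) σ').toFun (permGL Fin.revPerm * (x : GL (Fin n) F))) :=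
      f.2.comp_left (map_zero ℓ)
    exact hlc.continuous.integrable_of_hasCompactSupport hcs
  -- the scalar Haar functional `L(f) = ∫ ℓ(f(w₀ n')) dμ(n')`
  let lam : S →ₗ[ℂ] ℂ :=
    { toFun := fun f => ∫ x : ↥(oppositeCellRadical (K := F) c),
        ℓ ((f : Representation.SmoothInd (standardParabolicGL F c) σ').toFun (permGL Fin.revPerm * (x : GL (Fin n) F))) ∂μ
      map_add' := fun f g => by
        simp only [Submodule.coe_add, Representation.SmoothInd.toFun_add, Pi.add_apply, map_add]
        exact integral_add (hint f) (hint g)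
      map_smul' := fun a f => by
        simp only [Submodule.coe_smul, Representation.SmoothInd.toFun_smul, Pi.smul_apply, map_smul, smul_eq_mul, RingHom.id_apply]
        exact integral_const_mul a _ }
  have hlam : ∀ (x : ↥(oppositeCellRadical (K := F) c)) (f : S),
      lam ⟨((Representation.smoothIndRep (standardParabolicGL F c) σ').comp (oppositeCellRadical (K := F) c).subtype) x f, hS x f.2⟩ = lam f := fun x f => by
    change ∫ y : ↥(oppositeCellRadical (K := F) c), ℓ ((Representation.smoothIndRep (standardParabolicGL F c) σ' (x : GL (Fin n) F)
        (f : Representation.SmoothInd (standardParabolicGL F c) σ')).toFun (permGL Fin.revPerm * (y : GL (Fin n) F))) ∂μ =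
      ∫ y : ↥(oppositeCellRadical (K := F) c), ℓ ((f : Representation.SmoothInd (standardParabolicGL F c) σ').toFun (permGL Fin.revPerm * (y : GL (Fin n) F))) ∂μ
    have hcell : (fun y : ↥(oppositeCellRadical (K := F) c) => ℓ ((Representation.smoothIndRep (standardParabolicGL F c) σ' (x : GL (Fin n) F)
        (f : Representation.SmoothInd (standardParabolicGL F c) σ')).toFun (permGL Fin.revPerm * (y : GL (Fin n) F)))) =
        fun y : ↥(oppositeCellRadical (K := F) c) => ℓ ((f : Representation.SmoothInd (standardParabolicGL F c) σ').toFun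
          (permGL Fin.revPerm * ((y * x : ↥(oppositeCellRadical (K := F) c)) : GL (Fin n) F))) := by
      funext y
      simp only [Representation.toFun_smoothIndRep_apply, Subgroup.coe_mul, mul_assoc]
    rw [hcell]
    exact integral_mul_right_eq_self
      (fun y : ↥(oppositeCellRadical (K := F) c) => ℓ ((f : Representation.SmoothInd (standardParabolicGL F c) σ').toFun (permGL Fin.revPerm * (y : GL (Fin n) F)))) x
  -- the standard section lies in `S` and `lam` sees it
  have hcellΦ : (fun x : ↥(oppositeCellRadical (K := F) c) => (cellSection σ' hc hσ' K₀ hK₀o hK₀c w).toFun (permGL Fin.revPerm * (x : GL (Fin n) F))) =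
      (K₀ : Set ↥(oppositeCellRadical (K := F) c)).indicator (fun _ => w) := funext (toFun_cellSection_w₀_mul hc hσ' K₀ hK₀o hK₀c w)
  have hΦS : cellSection σ' hc hσ' K₀ hK₀o hK₀c w ∈ S := by
    change HasCompactSupport fun x : ↥(oppositeCellRadical (K := F) c) => (cellSection σ' hc hσ' K₀ hK₀o hK₀c w).toFun (permGL Fin.revPerm * (x : GL (Fin n) F))
    rw [hcellΦ]
    exact HasCompactSupport.of_support_subset_isCompact hK₀c Set.support_indicator_subset
  have hne : lam ⟨cellSection σ' hc hσ' K₀ hK₀o hK₀c w, hΦS⟩ ≠ 0 := by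
    change ∫ x : ↥(oppositeCellRadical (K := F) c), ℓ ((cellSection σ' hc hσ' K₀ hK₀o hK₀c w).toFun (permGL Fin.revPerm * (x : GL (Fin n) F))) ∂μ ≠ 0
    have h1 : (fun x : ↥(oppositeCellRadical (K := F) c) => ℓ ((cellSection σ' hc hσ' K₀ hK₀o hK₀c w).toFun (permGL Fin.revPerm * (x : GL (Fin n) F)))) =
        (K₀ : Set ↥(oppositeCellRadical (K := F) c)).indicator (fun _ => ℓ w) := by
      funext x
      rw [toFun_cellSection_w₀_mul hc hσ' K₀ hK₀o hK₀c w x]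
      by_cases hx : x ∈ (K₀ : Set ↥(oppositeCellRadical (K := F) c))
      · rw [Set.indicator_of_mem hx, Set.indicator_of_mem hx]
      · rw [Set.indicator_of_notMem hx, Set.indicator_of_notMem hx, map_zero]
    rw [h1, integral_indicator_const (ℓ w) hK₀o.measurableSet, Complex.real_smul, mul_ne_zero_iff]
    refine ⟨Complex.ofReal_ne_zero.2 ?_, hℓ⟩
    rw [Measure.real, ENNReal.toReal_ne_zero]
    exact ⟨hμo.open_pos _ hK₀o ⟨1, K₀.one_mem⟩, (hK₀c.measure_lt_top (μ := μ)).ne⟩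
  exact Representation.mk_coinvariants_ne_zero_of_apply_ne_zero hlim
    ((Representation.isSmooth_smoothInd (standardParabolicGL F c) σ').comp (oppositeCellRadical (K := F) c).subtype continuous_subtype_val)
    S hS lam hlam ⟨cellSection σ' hc hσ' K₀ hK₀o hK₀c w, hΦS⟩ hne

end Nonvanishing

end Summit.HodgeConjecture.HodgeConjecture.Cruxes.H413.K2E3OpenCellJacquetClasses

end
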